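import Mathlib
/-!
# Hodge-locus census, V3-XT N = 1 — ENGINE B: the INTEGER FORM (RR-int) of THEOREM-sketch RR-gen(ℓ), for every prime

certified instances and evidence bearing on the general Hodge conjecture; no claim.

Setting (`DERIVATION-RR-B.md` of the pub-hlocus cell, seat abs-2).  In the per-pair law RR-pair for two CM curves of `ℓ`-ramified
fundamental discriminants `D_a = ℓ d_a`, `D_b = ℓ d_b` reducing to the same supersingular curve, every unit `γ` of the maximal order
contributes the term `v_ℓ(2u·D_a - T_γ)`, where `T_γ = trd(Π_a · γΠ_bγ⁻¹) ≡ 0 (mod ℓ)` is an INTEGER but `u` (the Lie-normalised square root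
of `d_b/d_a`, `u² D_a = D_b`) is an `ℓ`-ADIC unit.  The census engines and the `decide` anchors (`HodgeLocusCensusRamRamAnchors.lean`) evaluate
instead the INTEGER FORM

  `term_γ = 1 + [ℓ² ∣ 2u·D_a - T_γ] · (v_ℓ(4 D_a D_b - T_γ²) - 2)`   (`[ℓ² ∣ 2uD_a - T] = [T/ℓ ≡ 2u d_a (mod ℓ)]`: only `u mod ℓ` enters),

together with the consistency check `v_ℓ(4D_aD_b - T²) > 2 ⟹ ℓ² ∣ 2uD_a - T or ℓ² ∣ 2uD_a + T` (never both).  This file proves that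
reduction ONCE, for every prime, as elementary statements about `padicValInt`:

* `padicValInt_eq_one_of_dvd_of_not_sq_dvd` : `p ∣ X`, `p² ∤ X` ⇒ `v_p X = 1`;
* `padicValInt_eq_ite_of_not_sq_dvd_add` (the core): `p ∣ X`, `p ∣ Y`, `p² ∤ X + Y` ⇒ `v_p X = if p² ∣ X then v_p(X·Y) - 1 else 1`
  — applied with `X = 2uD_a - T`, `Y = 2uD_a + T`, `X + Y = 4uD_a` (valuation exactly `1` for odd `ℓ`);
* `sq_dvd_or_sq_dvd_of_two_lt_padicValInt_mul` / `not_sq_dvd_and_sq_dvd` (consistency and exclusivity);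
* `padicValInt_eq_of_pow_dvd_sub'` (precision transfer): `p^M ∣ x - y`, `v_p y < M`, `y ≠ 0` ⇒ `v_p x = v_p y` — this is what allows the
  `ℓ`-adic unit `u` to be replaced by ANY integer `≡ u (mod ℓ^M)` and `4u²D_a² - T²` by `4D_aD_b - T²`;
* `termRR_integer_form` : the assembled statement — `ℓ` an odd prime, `ℓ ∥ D_a`, `ℓ ∤ u`, `ℓ ∣ T`, `ℓ^M ∣ u²D_a - D_b` with
  `M > v_ℓ(4D_aD_b - T²)`, `4D_aD_b ≠ T²`, `2uD_a + T ≠ 0`:  `v_ℓ(2uD_a - T) = if ℓ² ∣ 2uD_a - T then v_ℓ(4D_aD_b - T²) - 1 else 1`.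

Nothing here is a statement about algebraic cycles; it is the bookkeeping identity that lets the lattice side of RR-gen be evaluated and
certified in exact integer arithmetic (one residue of `u`, one integer valuation per unit `γ`).
-/

set_option linter.dupNamespace false

namespace Summit.HodgeConjecture.HodgeConjecture.HodgeLocus.Census.RamRamIntegerForm

variable {p : ℕ} [hp : Fact p.Prime]

/-- `p ∣ X` and `p² ∤ X` force `v_p X = 1` (and `X ≠ 0`). -/
theorem padicValInt_eq_one_of_dvd_of_not_sq_dvd {X : ℤ} (h1 : (p : ℤ) ∣ X) (h2 : ¬ (p : ℤ) ^ 2 ∣ X) :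
    padicValInt p X = 1 := by
  have hX0 : X ≠ 0 := by rintro rfl; exact h2 (dvd_zero _)
  have hge : 1 ≤ padicValInt p X := by
    rcases (padicValInt_dvd_iff 1 X).mp (by simpa using h1) with h | h
    · exact absurd h hX0
    · exact h
  have hlt : ¬ 2 ≤ padicValInt p X := fun h => h2 ((padicValInt_dvd_iff 2 X).mpr (Or.inr h))
  omega

/-- A valuation at least `2` means `p² ∣ X`. -/
theorem sq_dvd_of_two_le_padicValInt {X : ℤ} (h : 2 ≤ padicValInt p X) : (p : ℤ) ^ 2 ∣ X :=
  (padicValInt_dvd_iff 2 X).mpr (Or.inr h)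

/-- CORE of RR-int.  If `p ∣ X`, `p ∣ Y` and `p² ∤ X + Y` (the sum has valuation exactly `1`), then `v_p X = v_p(XY) - 1` when
`p² ∣ X` (for then `v_p Y = 1`), and `v_p X = 1` otherwise.  (`X = 0` is allowed: both sides are `0`.) -/
theorem padicValInt_eq_ite_of_not_sq_dvd_add {X Y : ℤ} (hY0 : Y ≠ 0) (hX : (p : ℤ) ∣ X) (hY : (p : ℤ) ∣ Y)
    (hs : ¬ (p : ℤ) ^ 2 ∣ X + Y) :
    padicValInt p X = if (p : ℤ) ^ 2 ∣ X then padicValInt p (X * Y) - 1 else 1 := by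
  by_cases h2 : (p : ℤ) ^ 2 ∣ X
  · rw [if_pos h2]
    by_cases hX0 : X = 0
    · subst hX0; simp [padicValInt.zero]
    · have hY2 : ¬ (p : ℤ) ^ 2 ∣ Y := fun h => hs (dvd_add h2 h)
      rw [padicValInt.mul hX0 hY0, padicValInt_eq_one_of_dvd_of_not_sq_dvd hY hY2]
      omega
  · rw [if_neg h2]
    exact padicValInt_eq_one_of_dvd_of_not_sq_dvd hX h2

/-- CONSISTENCY check of the engines: if moreover `v_p(XY) > 2` then `p²` divides `X` or `Y`
(so a residue `c` for which neither `2uD_a ∓ T` is divisible by `ℓ²` while `v(4D_aD_b - T²) > 2` is a wrong orientation). -/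
theorem sq_dvd_or_sq_dvd_of_two_lt_padicValInt_mul {X Y : ℤ} (hX0 : X ≠ 0) (hY0 : Y ≠ 0) (hX : (p : ℤ) ∣ X) (hY : (p : ℤ) ∣ Y)
    (h : 2 < padicValInt p (X * Y)) : (p : ℤ) ^ 2 ∣ X ∨ (p : ℤ) ^ 2 ∣ Y := by
  by_contra hh
  obtain ⟨h1, h2⟩ := not_or.mp hh
  rw [padicValInt.mul hX0 hY0, padicValInt_eq_one_of_dvd_of_not_sq_dvd hX h1,
    padicValInt_eq_one_of_dvd_of_not_sq_dvd hY h2] at h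
  omega

omit hp in
/-- EXCLUSIVITY: under `p² ∤ X + Y` the two divisibilities never hold together (`min(r⁺, r⁻) = 0`). -/
theorem not_sq_dvd_and_sq_dvd {X Y : ℤ} (hs : ¬ (p : ℤ) ^ 2 ∣ X + Y) : ¬ ((p : ℤ) ^ 2 ∣ X ∧ (p : ℤ) ^ 2 ∣ Y) :=
  fun h => hs (dvd_add h.1 h.2)

/-- PRECISION TRANSFER: if `p^M ∣ x - y` and `v_p y < M` (`y ≠ 0`), then `v_p x = v_p y`. -/
theorem padicValInt_eq_of_pow_dvd_sub' {x y : ℤ} {M : ℕ} (hy0 : y ≠ 0) (hM : (p : ℤ) ^ M ∣ x - y) (hlt : padicValInt p y < M) :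
    padicValInt p x = padicValInt p y := by
  have hx0 : x ≠ 0 := by
    rintro rfl
    have h' : (p : ℤ) ^ M ∣ y := by
      have := dvd_neg.mpr hM
      simpa using this
    rcases (padicValInt_dvd_iff M y).mp h' with h | h
    · exact hy0 h
    · omega
  set v := padicValInt p y with hv
  have hvy : (p : ℤ) ^ v ∣ y := padicValInt_dvd y
  have hge : v ≤ padicValInt p x := by
    have h1 : (p : ℤ) ^ v ∣ x - y := (pow_dvd_pow (p : ℤ) hlt.le).trans hM
    have h2 : (p : ℤ) ^ v ∣ x := by
      have := dvd_add h1 hvy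
      simpa using this
    rcases (padicValInt_dvd_iff v x).mp h2 with h | h
    · exact absurd h hx0
    · exact h
  have hle : ¬ v + 1 ≤ padicValInt p x := by
    intro h
    have h1 : (p : ℤ) ^ (v + 1) ∣ x := (padicValInt_dvd_iff (v + 1) x).mpr (Or.inr h)
    have h2 : (p : ℤ) ^ (v + 1) ∣ x - y := (pow_dvd_pow (p : ℤ) (by omega)).trans hM
    have h3 : (p : ℤ) ^ (v + 1) ∣ y := by
      have := dvd_sub h1 h2
      simpa using this
    rcases (padicValInt_dvd_iff (v + 1) y).mp h3 with h | h
    · exact hy0 h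
    · omega
  omega

/-- An odd prime does not divide `4`. -/
theorem not_dvd_four (hp2 : p ≠ 2) : ¬ (p : ℤ) ∣ 4 := by
  intro h
  have h' : p ∣ 2 ^ 2 := by exact_mod_cast h
  have h2 : p ∣ 2 := hp.out.dvd_of_dvd_pow h'
  exact hp2 ((Nat.prime_dvd_prime_iff_eq hp.out Nat.prime_two).mp h2)

/-- For an odd prime `ℓ`, `ℓ ∥ D_a` and `ℓ ∤ u`: `v_ℓ(4uD_a) = 1`, i.e. `ℓ² ∤ 4uD_a = (2uD_a - T) + (2uD_a + T)`. -/
theorem not_sq_dvd_four_mul (hp2 : p ≠ 2) {u Da : ℤ} (hu : ¬ (p : ℤ) ∣ u) (hDa1 : (p : ℤ) ∣ Da) (hDa2 : ¬ (p : ℤ) ^ 2 ∣ Da) :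
    ¬ (p : ℤ) ^ 2 ∣ 4 * u * Da := by
  have hu0 : u ≠ 0 := by rintro rfl; exact hu (dvd_zero _)
  have hDa0 : Da ≠ 0 := by rintro rfl; exact hDa2 (dvd_zero _)
  have h4 : padicValInt p (4 : ℤ) = 0 := padicValInt.eq_zero_of_not_dvd (not_dvd_four hp2)
  have hvu : padicValInt p u = 0 := padicValInt.eq_zero_of_not_dvd hu
  have hvD : padicValInt p Da = 1 := padicValInt_eq_one_of_dvd_of_not_sq_dvd hDa1 hDa2
  have hv : padicValInt p (4 * u * Da) = 1 := by
    rw [padicValInt.mul (mul_ne_zero (by norm_num) hu0) hDa0, padicValInt.mul (by norm_num) hu0, h4, hvu, hvD]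
  intro h
  rcases (padicValInt_dvd_iff 2 (4 * u * Da)).mp h with h' | h'
  · exact mul_ne_zero (mul_ne_zero (by norm_num) hu0) hDa0 h'
  · omega

/-- RR-int, assembled.  `ℓ` an odd prime; `ℓ ∥ D_a` (fundamental, `ℓ`-ramified); `u` an INTEGER prime to `ℓ` with `u²D_a ≡ D_b (mod ℓ^M)`
(any approximation of the `ℓ`-adic orientation to precision `M > v_ℓ(4D_aD_b - T²)`); `ℓ ∣ T` (`T = trd(Π_a·γΠ_bγ⁻¹)`); `4D_aD_b ≠ T²` and
`2uD_a + T ≠ 0` (true in the census: the term is finite).  Then the RR-pair term equals the integer form: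
`v_ℓ(2uD_a - T) = if ℓ² ∣ 2uD_a - T then v_ℓ(4D_aD_b - T²) - 1 else 1`  (`= 1 + [T/ℓ ≡ 2ud_a (ℓ)]·(v_ℓ(4D_aD_b - T²) - 2)`). -/
theorem termRR_integer_form (hp2 : p ≠ 2) {Da Db T u : ℤ} {M : ℕ} (hDa1 : (p : ℤ) ∣ Da) (hDa2 : ¬ (p : ℤ) ^ 2 ∣ Da)
    (hu : ¬ (p : ℤ) ∣ u) (hT : (p : ℤ) ∣ T) (hM : (p : ℤ) ^ M ∣ u ^ 2 * Da - Db) (hprec : padicValInt p (4 * Da * Db - T ^ 2) < M)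
    (h0 : 4 * Da * Db - T ^ 2 ≠ 0) (hY0 : 2 * u * Da + T ≠ 0) :
    padicValInt p (2 * u * Da - T) = if (p : ℤ) ^ 2 ∣ 2 * u * Da - T then padicValInt p (4 * Da * Db - T ^ 2) - 1 else 1 := by
  have hX : (p : ℤ) ∣ 2 * u * Da - T := dvd_sub (hDa1.mul_left _) hT
  have hY : (p : ℤ) ∣ 2 * u * Da + T := dvd_add (hDa1.mul_left _) hT
  have hs : ¬ (p : ℤ) ^ 2 ∣ (2 * u * Da - T) + (2 * u * Da + T) := by
    have : (2 * u * Da - T) + (2 * u * Da + T) = 4 * u * Da := by ring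
    rw [this]; exact not_sq_dvd_four_mul hp2 hu hDa1 hDa2
  have hcore := padicValInt_eq_ite_of_not_sq_dvd_add hY0 hX hY hs
  have hprod : (2 * u * Da - T) * (2 * u * Da + T) = 4 * u ^ 2 * Da ^ 2 - T ^ 2 := by ring
  have htr : padicValInt p (4 * u ^ 2 * Da ^ 2 - T ^ 2) = padicValInt p (4 * Da * Db - T ^ 2) := by
    refine padicValInt_eq_of_pow_dvd_sub' h0 ?_ hprec
    have : 4 * u ^ 2 * Da ^ 2 - T ^ 2 - (4 * Da * Db - T ^ 2) = (4 * Da) * (u ^ 2 * Da - Db) := by ring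
    rw [this]; exact hM.mul_left _
  rw [hcore, hprod, htr]

end Summit.HodgeConjecture.HodgeConjecture.HodgeLocus.Census.RamRamIntegerForm
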